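import Mathlib.RingTheory.AlgebraicIndependent.Adjoin
import Mathlib.RingTheory.AlgebraicIndependent.Transcendental
import Mathlib.FieldTheory.IntermediateField.Adjoin.Algebra
import Mathlib.RingTheory.Polynomial.UniqueFactorization
import Mathlib.RingTheory.Localization.Integral
import Mathlib.RingTheory.Algebraic.Integral
import Mathlib.Combinatorics.Nullstellensatz
import Mathlib.LinearAlgebra.Basis.VectorSpace
import Mathlib.RingTheory.Polynomial.RationalRoot
import Mathlib.Algebra.CharZero.Infinite
import Mathlib.Algebra.CharP.Algebra
import HarnessLib

/-!
# Relative algebraic closedness is preserved by purely transcendental extensions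

Let `k ⊆ K` be fields (inside an ambient field `Ω` of characteristic `0`) with `k` relatively
algebraically closed in `K`, and let `t = (tᵢ)` be a finite family of elements of `Ω`
algebraically independent over `K`. Then `k(t)` is relatively algebraically closed in `K(t)`:
an element of `K(t)` algebraic over `k(t)` lies in `k(t)` (Lang, *Algebra*, VIII §4, proof of
Thm 4.12 / folklore; the case `K = k` is the classical fact that `k` is algebraically closed in a
purely transcendental extension `k(t)`).

Proof: let `z ∈ K(t)` be algebraic over `k(t)`. Clearing denominators, `w = D z` is integral over
`k[t]` for some `0 ≠ D ∈ k[t]`, hence over `K[t]`, hence `w ∈ K[t]` (`K[t] ≅ K[X_ι]` is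
integrally closed). At every `k`-rational point `p`, the value `w(p) ∈ K` is integral over `k`,
so lies in `k`; applying a `k`-linear retraction `π : K → k` coefficientwise gives `w' ∈ k[t]`
with the same values at all `k`-rational points, so `w = w'` (`k` is infinite) and
`z = w / D ∈ k(t)`.

* `Literature.FieldTheory.Regular.mem_adjoin_of_isAlgebraic_of_algebraicIndependent` — the theorem.
* `Literature.FieldTheory.Regular.mem_of_isAlgebraic_of_mem_adjoin_of_algebraicIndependent` — the case `K = k`.

## References

* S. Lang, *Algebra*, 3rd ed., GTM 211, Springer 2002, VIII §4.
-/

noncomputable section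

open Set MvPolynomial

namespace Literature.FieldTheory.Regular

namespace RacPurelyTranscendental

variable {F₀ Ω : Type*} [Field F₀] [Field Ω] [Algebra F₀ Ω]

/-- A polynomial over a domain vanishing at all points with coordinates in an infinite subset is
zero (`MvPolynomial.eq_zero_of_eval_zero_at_prod_finset` on large enough finite grids).
[folklore] -/
theorem eq_zero_of_forall_eval_eq_zero {K : Type*} [CommRing K] [IsDomain K] {ι : Type*} [Fintype ι]
    {T : Set K} (hT : T.Infinite) (Q : MvPolynomial ι K)
    (hQ : ∀ x : ι → K, (∀ i, x i ∈ T) → eval x Q = 0) : Q = 0 := by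
  classical
  have hS : ∀ i, ∃ S : Finset K, (S : Set K) ⊆ T ∧ Q.degreeOf i < S.card := by
    intro i
    obtain ⟨S, hS, hcard⟩ := hT.exists_subset_card_eq (Q.degreeOf i + 1)
    exact ⟨S, hS, by omega⟩
  choose S hST hScard using hS
  exact eq_zero_of_eval_zero_at_prod_finset Q S hScard fun x hx => hQ x fun i => hST i (hx i)

/-- A polynomial over `K` all of whose values at `k`-rational points (for an infinite subfield
`k ≤ K`, inclusion `φ`) lie in `k` has coefficients in `k`. [folklore] -/
theorem exists_map_eq_of_eval_mem_range {k K : Type*} [Field k] [Field K] [Infinite k]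
    (φ : k →+* K) {ι : Type*} [Fintype ι] (P : MvPolynomial ι K)
    (hP : ∀ p : ι → k, eval (fun i => φ (p i)) P ∈ φ.range) :
    ∃ P₀ : MvPolynomial ι k, P = map φ P₀ := by
  classical
  letI : Algebra k K := φ.toAlgebra
  have hφ : ∀ a : k, algebraMap k K a = φ a := fun _ => rfl
  -- a `k`-linear retraction of `φ`
  obtain ⟨π, hπ⟩ := LinearMap.exists_leftInverse_of_injective (Algebra.linearMap k K)
    (LinearMap.ker_eq_bot.2 (algebraMap k K).injective)
  have hπφ : ∀ a : k, π (φ a) = a := fun a => by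
    have := congrArg (fun f => f a) hπ
    simp only [LinearMap.coe_comp, Function.comp_apply, Algebra.linearMap_apply, LinearMap.id_coe,
      id_eq] at this
    exact this
  -- coefficientwise retraction of `P`
  let P₀ : MvPolynomial ι k := ∑ m ∈ P.support, monomial m (π (coeff m P))
  have hcoeff : ∀ m, coeff m P₀ = π (coeff m P) := by
    intro m
    simp only [P₀, coeff_sum, coeff_monomial, Finset.sum_ite_eq', mem_support_iff, ne_eq, ite_not]
    split_ifs with h
    · rw [h, map_zero]
    · rfl
  -- `π (P(p)) = P₀(p)` at `k`-rational points
  have hsupp : P₀.support ⊆ P.support := by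
    intro m hm
    rw [mem_support_iff] at hm ⊢
    intro h0; apply hm; rw [hcoeff, h0, map_zero]
  have key : ∀ p : ι → k, π (eval (fun i => φ (p i)) P) = eval p P₀ := by
    intro p
    rw [eval_eq, eval_eq, map_sum]
    symm
    refine (Finset.sum_subset (s₁ := P₀.support) (s₂ := P.support) hsupp (fun m _ hm => ?_)).trans ?_
    · rw [mem_support_iff, not_not] at hm
      rw [hm, zero_mul]
    · refine Finset.sum_congr rfl fun m _ => ?_
      rw [hcoeff]
      have : (coeff m P * ∏ i ∈ m.support, φ (p i) ^ m i) = (∏ i ∈ m.support, p i ^ m i) • coeff m P := by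
        rw [Algebra.smul_def, hφ, map_prod, mul_comm]
        simp only [map_pow]
      rw [this, map_smul, smul_eq_mul, mul_comm]
  -- `map φ P₀` and `P` agree at all `k`-rational points
  have hval : ∀ p : ι → k, eval (fun i => φ (p i)) (map φ P₀) = eval (fun i => φ (p i)) P := by
    intro p
    obtain ⟨a, ha⟩ := hP p
    have ha' : a = eval p P₀ := by rw [← key, ← ha]; exact (hπφ a).symm
    have e1 := eval₂_comp_left φ (RingHom.id k) p P₀
    rw [RingHom.comp_id] at e1
    rw [eval_map, show (fun i => φ (p i)) = (φ : k → K) ∘ p from rfl, ← e1]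
    change φ (eval p P₀) = eval (fun i => φ (p i)) P
    rw [← ha', ha]
  -- hence they are equal
  refine ⟨P₀, ?_⟩
  have h0 : P - map φ P₀ = 0 := by
    refine eq_zero_of_forall_eval_eq_zero (infinite_range_of_injective φ.injective) _ fun x hx => ?_
    choose p hp using hx
    have hxp : x = fun i => φ (p i) := funext fun i => (hp i).symm
    rw [hxp, map_sub, hval, sub_self]
  exact (sub_eq_zero.1 h0)

open scoped IntermediateField.algebraAdjoinAdjoin

/-- **Relative algebraic closedness is preserved under purely transcendental extensions**
(Lang, *Algebra* VIII §4). Let `k ≤ K` be intermediate fields of `Ω/F₀` (`Ω` of characteristic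
`0`) with `k` relatively algebraically closed in `K`, and `t` a finite family algebraically
independent over `K`. Then every element of `K(t)` which is algebraic over `k(t)` lies in
`k(t)`. [cite: Lang2002, VIII §4] -/
theorem _root_.Literature.FieldTheory.Regular.mem_adjoin_of_isAlgebraic_of_algebraicIndependent [CharZero Ω]
    {k K : IntermediateField F₀ Ω} (hkK : k ≤ K)
    (hrac : ∀ z : Ω, z ∈ K → IsAlgebraic k z → z ∈ k)
    {ι : Type*} [Fintype ι] (t : ι → Ω) (ht : AlgebraicIndependent K t)
    {z : Ω} (hz : z ∈ IntermediateField.adjoin K (range t))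
    (halg : IsAlgebraic (IntermediateField.adjoin k (range t)) z) :
    z ∈ IntermediateField.adjoin k (range t) := by
  classical
  -- the inclusion `φ : k → K` and the tower `k → K → Ω`
  let φ : k →+* K := (IntermediateField.inclusion hkK : k →ₐ[F₀] K)
  letI : Algebra k K := φ.toAlgebra
  haveI : IsScalarTower k K Ω := IsScalarTower.of_algebraMap_eq (fun _ => rfl)
  haveI : Infinite k := CharZero.infinite k
  have htk : AlgebraicIndependent k t := ht.restrictScalars φ.injective
  -- membership in the polynomial subalgebras `r = k[t]`, `R = K[t]`
  have hmem_r : ∀ Q : MvPolynomial ι k, aeval t Q ∈ Algebra.adjoin k (range t) := fun Q => by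
    rw [Algebra.adjoin_range_eq_range_aeval]; exact ⟨Q, rfl⟩
  have hmem_R : ∀ Q : MvPolynomial ι K, aeval t Q ∈ Algebra.adjoin K (range t) := fun Q => by
    rw [Algebra.adjoin_range_eq_range_aeval]; exact ⟨Q, rfl⟩
  have hrR : ∀ y : Ω, y ∈ Algebra.adjoin k (range t) → y ∈ Algebra.adjoin K (range t) := by
    intro y hy
    rw [Algebra.adjoin_range_eq_range_aeval] at hy
    obtain ⟨Q, rfl⟩ := hy
    have : aeval t Q = aeval t (map φ Q) := by rw [aeval_def, aeval_def, eval₂_map]; rfl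
    rw [AlgHom.toRingHom_eq_coe, RingHom.coe_coe, this]
    exact hmem_R _
  -- Step 1: `D • z` integral over `r` for some `0 ≠ D ∈ r`
  have halg_r : IsAlgebraic (Algebra.adjoin k (range t)) z :=
    (IsFractionRing.isAlgebraic_iff (Algebra.adjoin k (range t))
      (IntermediateField.adjoin k (range t)) Ω).2 halg
  obtain ⟨D, hD0, q, hqm, hq0⟩ := halg_r.exists_integral_multiple
  have hDz : (D : Ω) * z = D • z := rfl
  rw [← hDz] at hq0
  -- the inclusion `ρ : r → R`
  let ρ : Algebra.adjoin k (range t) →+* Algebra.adjoin K (range t) :=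
    ((Algebra.adjoin k (range t)).val : _ →+* Ω).codRestrict (Algebra.adjoin K (range t)).toSubring
      fun y => hrR y y.2
  -- Step 2: `w = D z ∈ K(t)` is integral over `R`, hence lies in `R` (`R ≅ K[X_ι]` is a UFD)
  have hwKt : (D : Ω) * z ∈ IntermediateField.adjoin K (range t) :=
    mul_mem (IntermediateField.algebra_adjoin_le_adjoin K _ (hrR _ D.2)) hz
  have hintR : IsIntegral (Algebra.adjoin K (range t))
      (⟨(D : Ω) * z, hwKt⟩ : IntermediateField.adjoin K (range t)) := by
    refine ⟨q.map ρ, hqm.map ρ, Subtype.ext ?_⟩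
    show ((Polynomial.eval₂ (algebraMap _ (IntermediateField.adjoin K (range t))) ⟨(D : Ω) * z, hwKt⟩
      (q.map ρ) : IntermediateField.adjoin K (range t)) : Ω) = 0
    rw [Polynomial.eval₂_map,
      show ((Polynomial.eval₂ ((algebraMap _ (IntermediateField.adjoin K (range t))).comp ρ)
          ⟨(D : Ω) * z, hwKt⟩ q : IntermediateField.adjoin K (range t)) : Ω) =
        (algebraMap (IntermediateField.adjoin K (range t)) Ω)
          (Polynomial.eval₂ ((algebraMap _ (IntermediateField.adjoin K (range t))).comp ρ) ⟨(D : Ω) * z, hwKt⟩ q)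
        from rfl,
      Polynomial.hom_eval₂]
    exact hq0
  haveI : UniqueFactorizationMonoid (Algebra.adjoin K (range t)) :=
    (ht.aevalEquiv : MvPolynomial ι K ≃ₐ[K] Algebra.adjoin K (range t)).toMulEquiv.uniqueFactorizationMonoid
      inferInstance
  have hwR : (D : Ω) * z ∈ Algebra.adjoin K (range t) := by
    obtain ⟨y, hy⟩ := (isIntegrallyClosed_iff (IntermediateField.adjoin K (range t))).1
      (UniqueFactorizationMonoid.instIsIntegrallyClosed) hintR
    have : (y : Ω) = (D : Ω) * z := congrArg Subtype.val hy
    rw [← this]; exact y.2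
  -- Step 3: `w = P(t)` with `P ∈ K[X]`; the values of `P` at `k`-rational points lie in `k`
  obtain ⟨P, hP⟩ : ∃ P : MvPolynomial ι K, aeval t P = (D : Ω) * z := by
    rw [Algebra.adjoin_range_eq_range_aeval] at hwR; exact hwR
  have hvals : ∀ p : ι → k, eval (fun i => φ (p i)) P ∈ φ.range := by
    intro p
    -- specialisation `t ↦ p` on `R` and on `r`
    let ev : Algebra.adjoin K (range t) →ₐ[K] K :=
      (aeval fun i => (φ (p i) : K)).comp (ht.aevalEquiv.symm : Algebra.adjoin K (range t) →ₐ[K] MvPolynomial ι K)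
    have hev_t : ∀ Q : MvPolynomial ι K, ev ⟨aeval t Q, hmem_R Q⟩ = aeval (fun i => (φ (p i) : K)) Q := by
      intro Q
      have eQ : (ht.aevalEquiv Q : Algebra.adjoin K (range t)) = ⟨aeval t Q, hmem_R Q⟩ :=
        Subtype.ext (by simp [AlgebraicIndependent.aevalEquiv])
      show aeval _ (ht.aevalEquiv.symm _) = _
      rw [← eQ, AlgEquiv.symm_apply_apply]
    let ψ₀ : Algebra.adjoin k (range t) →+* k :=
      (eval p : MvPolynomial ι k →+* k).comp (htk.aevalEquiv.symm : Algebra.adjoin k (range t) →ₐ[k] MvPolynomial ι k)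
    have hcompat : ∀ y : Algebra.adjoin k (range t), φ (ψ₀ y) = ev (ρ y) := by
      intro y
      obtain ⟨Q, rfl⟩ := htk.aevalEquiv.surjective y
      have eQ : (htk.aevalEquiv Q : Algebra.adjoin k (range t)) = ⟨aeval t Q, hmem_r Q⟩ :=
        Subtype.ext (by simp [AlgebraicIndependent.aevalEquiv])
      have e1 : ρ ⟨aeval t Q, hmem_r Q⟩ = ⟨aeval t (map φ Q), hmem_R _⟩ := by
        apply Subtype.ext
        show aeval t Q = aeval t (map φ Q)
        rw [aeval_def, aeval_def, eval₂_map]; rfl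
      show φ (eval p (htk.aevalEquiv.symm (htk.aevalEquiv Q))) = ev (ρ (htk.aevalEquiv Q))
      rw [AlgEquiv.symm_apply_apply, eQ, e1, hev_t, aeval_def, eval₂_map]
      have e2 := eval₂_comp_left φ (RingHom.id k) p Q
      rw [RingHom.comp_id] at e2
      rw [show (algebraMap K K).comp φ = φ from RingHom.ext fun _ => rfl,
        show (fun i => φ (p i)) = (φ : k → K) ∘ p from rfl, ← e2]
      rfl
    -- integrality of the value `ev (D z)` over `k`
    have hDzR : (⟨(D : Ω) * z, hwR⟩ : Algebra.adjoin K (range t)) = ⟨aeval t P, hmem_R P⟩ :=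
      Subtype.ext hP.symm
    have hval_eq : eval (fun i => φ (p i)) P = ev ⟨(D : Ω) * z, hwR⟩ := by
      rw [hDzR, hev_t]; rfl
    have hq0R : Polynomial.eval₂ ρ (⟨(D : Ω) * z, hwR⟩ : Algebra.adjoin K (range t)) q = 0 := by
      apply Subtype.ext
      rw [show ((Polynomial.eval₂ ρ (⟨(D : Ω) * z, hwR⟩ : Algebra.adjoin K (range t)) q :
          Algebra.adjoin K (range t)) : Ω) =
        ((Algebra.adjoin K (range t)).val : _ →+* Ω) (Polynomial.eval₂ ρ ⟨(D : Ω) * z, hwR⟩ q) from rfl,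
        Polynomial.hom_eval₂]
      exact hq0
    have hintK : IsIntegral k (ev ⟨(D : Ω) * z, hwR⟩) := by
      refine ⟨q.map ψ₀, hqm.map ψ₀, ?_⟩
      rw [Polynomial.eval₂_map]
      have e3 : (algebraMap k K).comp ψ₀ = (ev : Algebra.adjoin K (range t) →+* K).comp ρ :=
        RingHom.ext fun y => hcompat y
      rw [e3, show ev ⟨(D : Ω) * z, hwR⟩ = (ev : Algebra.adjoin K (range t) →+* K) ⟨(D : Ω) * z, hwR⟩ from rfl,
        ← Polynomial.hom_eval₂, hq0R, map_zero]
    -- hence in `k` by relative algebraic closedness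
    have hyK : ((ev ⟨(D : Ω) * z, hwR⟩ : K) : Ω) ∈ K := (ev ⟨(D : Ω) * z, hwR⟩).2
    have hyalg : IsAlgebraic k ((ev ⟨(D : Ω) * z, hwR⟩ : K) : Ω) :=
      (hintK.map (IsScalarTower.toAlgHom k K Ω)).isAlgebraic
    refine ⟨⟨_, hrac _ hyK hyalg⟩, ?_⟩
    rw [hval_eq]
    exact Subtype.ext rfl
  obtain ⟨P₀, hP₀⟩ := exists_map_eq_of_eval_mem_range φ P hvals
  -- Step 4: conclude `z = P₀(t) / D ∈ k(t)`
  have hwkt : (D : Ω) * z ∈ IntermediateField.adjoin k (range t) := by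
    rw [← hP, hP₀, aeval_def, eval₂_map]
    exact IntermediateField.algebra_adjoin_le_adjoin k _ (hmem_r P₀)
  have hDkt : (D : Ω) ∈ IntermediateField.adjoin k (range t) :=
    IntermediateField.algebra_adjoin_le_adjoin k _ D.2
  have hD0' : (D : Ω) ≠ 0 := fun h => hD0 (Subtype.ext h)
  have : z = ((D : Ω))⁻¹ * ((D : Ω) * z) := by rw [← mul_assoc, inv_mul_cancel₀ hD0', one_mul]
  rw [this]
  exact mul_mem (inv_mem hDkt) hwkt

/-- **A field is relatively algebraically closed in a purely transcendental extension**: for `t`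
algebraically independent over `k` (an intermediate field of `Ω/F₀`, characteristic `0`), every
element of `k(t)` algebraic over `k` lies in `k`. (Write `z ∈ k[t]` by integral closedness of
`k[t] ≅ k[X_ι]`; its values at `k`-rational points are roots of the minimal polynomial, so
`∏_c (z − c)` vanishes on `kⁿ`, forcing `z` to be constant.) [cite: Lang2002, VIII §4] -/
theorem _root_.Literature.FieldTheory.Regular.mem_of_isAlgebraic_of_mem_adjoin_of_algebraicIndependent [CharZero Ω]
    (k : IntermediateField F₀ Ω) {ι : Type*} [Fintype ι] (t : ι → Ω) (ht : AlgebraicIndependent k t)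
    {z : Ω} (hz : z ∈ IntermediateField.adjoin k (range t)) (halg : IsAlgebraic k z) : z ∈ k := by
  classical
  haveI : Infinite k := CharZero.infinite k
  have hmem_r : ∀ Q : MvPolynomial ι k, aeval t Q ∈ Algebra.adjoin k (range t) := fun Q => by
    rw [Algebra.adjoin_range_eq_range_aeval]; exact ⟨Q, rfl⟩
  -- `z` is integral over `k`, hence over `r = k[t]`, hence in `r`
  obtain ⟨m, hmm, hm0⟩ := halg.isIntegral
  have hint : IsIntegral (Algebra.adjoin k (range t)) (⟨z, hz⟩ : IntermediateField.adjoin k (range t)) := by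
    refine ⟨m.map (algebraMap k _), hmm.map _, Subtype.ext ?_⟩
    show ((Polynomial.eval₂ (algebraMap _ (IntermediateField.adjoin k (range t))) ⟨z, hz⟩
      (m.map (algebraMap k (Algebra.adjoin k (range t)))) : IntermediateField.adjoin k (range t)) : Ω) = 0
    rw [Polynomial.eval₂_map,
      show ((Polynomial.eval₂ ((algebraMap _ (IntermediateField.adjoin k (range t))).comp (algebraMap k _))
          ⟨z, hz⟩ m : IntermediateField.adjoin k (range t)) : Ω) =
        (algebraMap (IntermediateField.adjoin k (range t)) Ω)
          (Polynomial.eval₂ ((algebraMap _ (IntermediateField.adjoin k (range t))).comp (algebraMap k _)) ⟨z, hz⟩ m)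
        from rfl,
      Polynomial.hom_eval₂]
    exact hm0
  haveI : UniqueFactorizationMonoid (Algebra.adjoin k (range t)) :=
    (ht.aevalEquiv : MvPolynomial ι k ≃ₐ[k] Algebra.adjoin k (range t)).toMulEquiv.uniqueFactorizationMonoid
      inferInstance
  obtain ⟨P, hP⟩ : ∃ P : MvPolynomial ι k, aeval t P = z := by
    obtain ⟨y, hy⟩ := (isIntegrallyClosed_iff (IntermediateField.adjoin k (range t))).1
      (UniqueFactorizationMonoid.instIsIntegrallyClosed) hint
    have hy' : (y : Ω) = z := congrArg Subtype.val hy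
    have hy2 : z ∈ Algebra.adjoin k (range t) := hy' ▸ y.2
    rw [Algebra.adjoin_range_eq_range_aeval] at hy2
    obtain ⟨P, hP⟩ := hy2
    exact ⟨P, hP⟩
  -- values at rational points are roots of `m`
  have hroot : ∀ p : ι → k, Polynomial.aeval (eval p P) m = 0 := by
    intro p
    let ev : Algebra.adjoin k (range t) →ₐ[k] k :=
      (aeval p).comp (ht.aevalEquiv.symm : Algebra.adjoin k (range t) →ₐ[k] MvPolynomial ι k)
    have hev : ev ⟨aeval t P, hmem_r P⟩ = eval p P := by
      have eQ : (ht.aevalEquiv P : Algebra.adjoin k (range t)) = ⟨aeval t P, hmem_r P⟩ :=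
        Subtype.ext (by simp [AlgebraicIndependent.aevalEquiv])
      show aeval p (ht.aevalEquiv.symm _) = _
      rw [← eQ, AlgEquiv.symm_apply_apply]
      rfl
    have hzr : Polynomial.aeval (⟨aeval t P, hmem_r P⟩ : Algebra.adjoin k (range t)) m = 0 := by
      apply Subtype.ext
      have e := Polynomial.aeval_algHom_apply (Algebra.adjoin k (range t)).val
        (⟨aeval t P, hmem_r P⟩ : Algebra.adjoin k (range t)) m
      rw [show (((Polynomial.aeval (⟨aeval t P, hmem_r P⟩ : Algebra.adjoin k (range t)) m :
          Algebra.adjoin k (range t)) : Ω)) = (Algebra.adjoin k (range t)).val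
            (Polynomial.aeval (⟨aeval t P, hmem_r P⟩ : Algebra.adjoin k (range t)) m) from rfl, ← e]
      show Polynomial.aeval (aeval t P) m = ((0 : Algebra.adjoin k (range t)) : Ω)
      rw [hP]
      exact hm0
    have e2 := Polynomial.aeval_algHom_apply ev (⟨aeval t P, hmem_r P⟩ : Algebra.adjoin k (range t)) m
    rw [← hev, e2, hzr, map_zero]
  -- `∏_{c root of m} (P − c)` vanishes on `kⁿ`, so `P` is constant
  have hm0' : m ≠ 0 := hmm.ne_zero
  set S := m.roots.toFinset with hS
  have hprod : (∏ c ∈ S, (P - C c)) = 0 := by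
    refine eq_zero_of_forall_eval_eq_zero (T := Set.univ) Set.infinite_univ _ fun p _ => ?_
    rw [map_prod]
    refine Finset.prod_eq_zero (i := eval p P) ?_ (by simp)
    rw [hS, Multiset.mem_toFinset, Polynomial.mem_roots hm0']
    exact hroot p
  obtain ⟨c, -, hc⟩ := Finset.prod_eq_zero_iff.1 hprod
  rw [sub_eq_zero] at hc
  rw [← hP, hc, aeval_C]
  exact c.2


end RacPurelyTranscendental

end Literature.FieldTheory.Regular
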